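import Summits.Langlands.Langlands.Theses.SqrtFiveQuarticCovers
import Literature.NumberTheory.Automorphic.TotallyRealModularitySmallImage
import HarnessLib

/-!
# Route `SqrtFiveQuarticCovers` — crux `BoxQuartic` (stmt-Langlands-17836), line `birth`:
# stub `stub_borelFiveLocusModular` (Box 2022, Thm. 1.5 with Thm. 1.4)

The registered stub `stub_borelFiveLocusModular` of the skeleton
`Summits/Langlands/Langlands/Cruxes/BoxQuartic/Lines/birth.lean` says: for `K` totally real
QUARTIC (no hypothesis on `√5`) and an integral model `E / 𝓞 K` with `Δ(E) ≠ 0` admitting framings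
of `E[3]`, `E[5]`, `E[7]` (`WeierstrassCurve.IsTorsionGaloisRep`, written out) with mod-`3` image in
`B(3)` or `C_s⁺(3) = ⟨diag(1,2), (0 1; 1 0)⟩`, mod-`5` image in `B(5)` and mod-`7` image in `B(7)`
or `G(e7) = ⟨(0 5; 3 0), (5 0; 3 2)⟩`, the curve is modular in the trace-only sense of the summit's
cone (`Literature.NumberTheory.Automorphic.IsModularEllipticCurve K E`, written out).  This is
J. Box, Trans. AMS 375 (2022), Thm. 1.5 (all quartic points with quartic `j` on `X₀(105)`,
`X(s3,b5,b7)`, `X(b3,b5,e7)`, `X(s3,b5,e7)` are `ℚ`-curves or have a non-totally-real `j`) with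
Thm. 1.4 (Ribet: `ℚ`-curves are modular) and the small-`j` paragraph of §1.1 — the load-bearing
stub of the line, and the sibling crux `BoxBorelFive` (stmt-Langlands-17835) with its hypothesis
`√5 ∈ K` deleted.

HONEST STATUS — CONDITIONAL.  Box §§3–6 (quartic points on four modular curves of genus 13–153 by
quotients, symmetric Chabauty and Mordell–Weil sieves, in Magma) is held by the tree as the NAMED
FACT `Box2022_theorem1_5_modular` (D-0014), stated for ALL totally real quartic `K`.  The theorem
`stub_borelFiveLocusModular_of_Box2022_theorem1_5_modular` takes it as an explicit hypothesis and
is otherwise the two PROVED bridges `Box2022_theorem1_5_modular.isHilbertModular` (cofinite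
Hecke-polynomial form) and `IsHilbertModular.isModularEllipticCurve` (trace form = the cone); the
written-out framing hypotheses are `IsTorsionGaloisRep` by `δ`.  Nothing here determines a quartic
point; the file is the kernel-checked deduction of the stub from the printed theorem it consumes.

References: [Box2022] arXiv:2103.13975, §1.1, Thms. 1.4–1.5 (p. 5), Thms. 3.1, 4.1, 6.1,
Cor. 5.3; [Ribet2004QCurves] K. Ribet, Progr. Math. 224 (2004) 241–261.
-/

noncomputable section

set_option linter.dupNamespace false -- project-wide option; `Summit.Langlands.Langlands` is the mandated namespace

open scoped MatrixGroups NumberField Matrix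
open NumberField
open Literature.NumberTheory.Automorphic Literature.NumberTheory.GaloisRepresentations
open Summit.Langlands.Langlands.Theses.SqrtFiveQuarticCovers

namespace Summit.Langlands.Langlands.Theorems

/-- **Stub `stub_borelFiveLocusModular` from the named fact `Box2022_theorem1_5_modular`** (Box
2022, Thm. 1.5 with Thm. 1.4, taken as a hypothesis — CONDITIONAL).  For `K` totally real quartic
and `E / 𝓞 K` (`Δ ≠ 0`) with mod-`3` image in `B(3)` or `C_s⁺(3)`, mod-`5` image in `B(5)` and
mod-`7` image in `B(7)` or `G(e7)` (each for some framing), `E` is modular in the written-out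
trace-only sense.  Proof: the fact gives `IsAutomorphicOfWeightZero E`;
`Box2022_theorem1_5_modular.isHilbertModular` and `IsHilbertModular.isModularEllipticCurve`
translate it into the cone; framings and cone close by `δ`.  The statement is the registered stub
signature verbatim (no `√5` hypothesis — the fact has none either).
[cite: Box2022, Thm. 1.5, Thm. 1.4, §1.1 (p. 5)] -/
theorem stub_borelFiveLocusModular_of_Box2022_theorem1_5_modular (h : Box2022_theorem1_5_modular) :
    ∀ (K : Type) [Field K] [NumberField K], NumberField.IsTotallyReal K → Module.finrank ℚ K = 4 → ∀ E : WeierstrassCurve (NumberField.RingOfIntegers K), E.Δ ≠ 0 → (∃ ρ : Literature.NumberTheory.GaloisRepresentations.FramedGaloisRep K (ZMod 3) 2, (∃ e : (E.baseChange K).geomTorsion ((3 : ℕ) : ℤ) ≃+ (Fin 2 → ZMod 3), ∀ (σ : Field.absoluteGaloisGroup K) (P : (E.baseChange K).geomTorsion ((3 : ℕ) : ℤ)), e (σ • P) = ((ρ σ : GL (Fin 2) (ZMod 3)) : Matrix (Fin 2) (Fin 2) (ZMod 3)) *ᵥ (e P)) ∧ ((∀ σ : Field.absoluteGaloisGroup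 K, (((ρ σ : GL (Fin 2) (ZMod 3)) : Matrix (Fin 2) (Fin 2) (ZMod 3)) 1 0 = 0)) ∨ (∀ σ : Field.absoluteGaloisGroup K, (ρ σ : GL (Fin 2) (ZMod 3)) ∈ Subgroup.closure ({(⟨!![1, 0; 0, 2], !![1, 0; 0, 2], by decide, by decide⟩ : GL (Fin 2) (ZMod 3)), (⟨!![0, 1; 1, 0], !![0, 1; 1, 0], by decide, by decide⟩ : GL (Fin 2) (ZMod 3))} : Set (GL (Fin 2) (ZMod 3)))))) → (∃ ρ : Literature.NumberTheory.GaloisRepresentations.FramedGaloisRep K (ZMod 5) 2, (∃ e : (E.baseChange K).geomTorsion ((5 : ℕ) : ℤ) ≃+ (Fin 2 → ZMod 5), ∀ (σ : Field.absoluteGaloisGroup K) (P : (E.baseChange K).geomTorsion ((5 : ℕ) : ℤ)), e (σ • P) = ((ρ σ : GL (Fin 2) (ZMod 5)) : Matrix (Fin 2) (Fin 2) (ZMod 5)) *ᵥ (e P)) ∧ (∀ σ : Field.absoluteGaloisGroup K, (((ρ σ : GL (Fin 2) (ZMod 5)) : Matrix (Fin 2) (Fin 2) (ZMod 5)) 1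 0 = 0))) → (∃ ρ : Literature.NumberTheory.GaloisRepresentations.FramedGaloisRep K (ZMod 7) 2, (∃ e : (E.baseChange K).geomTorsion ((7 : ℕ) : ℤ) ≃+ (Fin 2 → ZMod 7), ∀ (σ : Field.absoluteGaloisGroup K) (P : (E.baseChange K).geomTorsion ((7 : ℕ) : ℤ)), e (σ • P) = ((ρ σ : GL (Fin 2) (ZMod 7)) : Matrix (Fin 2) (Fin 2) (ZMod 7)) *ᵥ (e P)) ∧ ((∀ σ : Field.absoluteGaloisGroup K, (((ρ σ : GL (Fin 2) (ZMod 7)) : Matrix (Fin 2) (Fin 2) (ZMod 7)) 1 0 = 0)) ∨ (∀ σ : Field.absoluteGaloisGroup K, (ρ σ : GL (Fin 2) (ZMod 7)) ∈ Subgroup.closure ({(⟨!![0, 5; 3, 0], !![0, 5; 3, 0], by decide, by decide⟩ : GL (Fin 2) (ZMod 7)), (⟨!![5, 0; 3, 2], !![3, 0; 6, 4], by decide, by decide⟩ : GL (Fin 2) (ZMod 7))} : Set (GL (Fin 2) (ZMod 7)))))) → ((E.baseChange K).HasCM ∨ ∃ (hF : Literature.NumberTheory.Automorphic.isCompact_glFiniteIntegralLevel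 2 K) (π : Literature.NumberTheory.Automorphic.CuspidalAutomorphicRepData 2 K hF), π.1.HasWeightZero ∧ ∀ᶠ w : IsDedekindDomain.HeightOneSpectrum (NumberField.RingOfIntegers K) in Filter.cofinite, ∃ α : Multiset ℂ, π.1.HasSatakeParamAt w α ∧ ((Real.sqrt w.residueCard : ℝ) : ℂ) * α.sum = (Literature.NumberTheory.Automorphic.frobTraceAt E w : ℂ)) := by
  intro K _ _ hK hd E hE h3 h5 h7
  haveI : IsTotallyReal K := hK
  exact (Box2022_theorem1_5_modular.isHilbertModular h K hd hE h3 h5 h7).isModularEllipticCurve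

end Summit.Langlands.Langlands.Theorems

end
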